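import Summits.QuantumFields.BalabanUV.T4Continuum.Support.NE3TangentFlatStructure
import Literature.MathematicalPhysics.QuantumFieldTheory.Balaban1983to89.T4TermwiseTorus
import HarnessLib

/-!
# T⁴ programme, node NE3 — THE k-FOLD STRAIGHT AVERAGE IS THE BLOCK LINE MEAN: tiling `(Qcoarse L)^[k] Y (Z,κ) =
# (L^{kd})⁻¹ Σ_{x∈B^k(L^kZ)} Σ_{i<L^k} Y(x + ie_κ, κ)`, and its two GRADIENT-CURRENCY estimates (mean defect, coarse divergence)

NE3 formalisation swarm `b2b-balaban-t4-ne3-formalise-*`, LEAF PROVER 04 (gen 4), row **E-MLw-w3** of `t4/formal/NE3/LEAVES.md`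
(typer v1.44; owner skeleton v1.9 §4b (w3)), file (B) of the SHAPE note `t4/formal/NE3/Statements/E-MLw-w3-SHAPE-v1.md`; on file (A)
`Support/NE3TangentFlatStructure` (`Qcoarse`, `iterate_Tcoarse_eq`: the k-fold tangent space at the flat background is «straight
k-block average coarse-exact»).

CONTENT (all [folklore]; 0 sorry; 0 def; values in an arbitrary normed ℂ-algebra `𝔸` — `Matrix n n ℂ` and `ℂ` included):
§1 reindexing: `sum_range_mul` (`Σ_{j<a·b} f j = Σ_{i<a} Σ_{t<b} f(b·i + t)`), `sum_univ_boxVec` (`Σ_r g(boxVec M r) = Σ_{v∈[0,M)^d} g v`,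
   via the tree's `T4TermwiseTorus.boxVec_injective`),
   `sum_blocks_eq'` (`T4AveragingDeficitWallBoundary.sum_blocks_eq` for vector values), `sum_periodBox_blocks`
   (`Σ_{y∈[0,L)^d} Σ_{v∈[0,M)^d} g(M•y + v) = Σ_{w∈[0,ML)^d} g w`).
§2 **`Qcoarse_apply`** (one level: `Qcoarse L Y z κ = (L^d)⁻¹ • Σ_{v∈[0,L)^d} Σ_{i<L} Y(L•z + v + ie_κ, κ)`) and the TILING
   **`iterate_Qcoarse_apply`**: `(Qcoarse L)^[k] Y z κ = ((L^k)^d)⁻¹ • Σ_{v∈[0,L^k)^d} Σ_{i<L^k} Y(L^k•z + v + ie_κ, κ)` — the k-fold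
   straight average IS the mean of `Y_κ` over the `L^k`-block LINES (block × segment of length `L^k`), by the digit decomposition.
§3 the two estimates every Poincaré argument on the tangent space needs, in the GRADIENT currency and for any norm:
   **`norm_lineMean_sub_blockMean_le`**: `‖Σ_{v}Σ_{i<M} Y(q+v+ie_κ,κ) − M•Σ_v Y(q+v,κ)‖ ≤ M·Σ_v Σ_{j<M} ‖∂_κY_κ(q+v+je_κ)‖`
   (telescoping along the segment), its Cauchy–Schwarz square `…_sq_le`, and **`norm_lineMean_sub_shift_le`**:
   `‖Σ_vΣ_i Y(q+v+ie_κ) − Σ_vΣ_i Y(q−Me_κ+v+ie_κ)‖ ≤ Σ_v Σ_{i<M} Σ_{j<M} ‖∂_κY_κ(q − Me_κ + v + (i+j)e_κ)‖` (the coarse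
   backward difference of the line mean telescopes to block sums of `∂_κY_κ`), with its square `…_sq_le`; here
   `∂_κY_κ(p) := Y(p + e_κ, κ) − Y(p, κ)`, `M = L^k`, `q = M•z` the block corner.

HONEST FRAMING.  Lattice bookkeeping of the linearised straight average at the FLAT configuration (our frame); identities and
triangle∕Cauchy–Schwarz inequalities only; nothing about Bałaban's minimisers, (ML_w), T-E_w or NE3 is asserted; NE3 NOT proved;
spine 0∕9; finite T⁴ rung (B)+1 — NOT infinite volume, NOT mass gap, NOT BetaPertH, NOT Clay.  ABSOLUTE RULE kept (context only:
[Balaban1985Averaging] (122)∕(125) p. 36 — `L·Q₀`; [Balaban1984PropagatorsI] (1.20)–(1.21) p. 20 — the straight block averages).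
PLACEMENT: `Summits/QuantumFields/BalabanUV/`; imports file (A) and the tree's `T4TermwiseTorus` (for `boxVec_injective`) only.
-/

set_option autoImplicit false

open scoped BigOperators
open Finset

namespace Summit.QuantumFields.BalabanUV.T4Continuum.NE3BlockLineAverage

open Literature.MathematicalPhysics.QuantumFieldTheory.Balaban1983to89
open B7Prop1Explicit B7Prop3Flat
open T4AveragingDeficitWallBoundary (periodBox mem_periodBox card_periodBox blockSites_periodBox blockSites_eq_image
  blockMap_injective)
open NE3TangentFlatStructure (Qcoarse)

noncomputable section

variable {d : ℕ}

/-! ## §1 Reindexing: digits along a segment, digits in a block -/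

/-- `Σ_{j < a·b} f j = Σ_{i<a} Σ_{t<b} f (b·i + t)` (division with remainder along a segment). [folklore] -/
theorem sum_range_mul {β : Type*} [AddCommMonoid β] (a b : ℕ) (f : ℕ → β) :
    ∑ j ∈ range (a * b), f j = ∑ i ∈ range a, ∑ t ∈ range b, f (b * i + t) := by
  induction a with
  | zero => simp
  | succ a ih =>
      rw [Nat.succ_mul, Finset.sum_range_add, ih, Finset.sum_range_succ, Nat.mul_comm b a]

/-- `Σ_{r : [0,M)^d} g(boxVec M r) = Σ_{v ∈ periodBox M} g v`. [folklore] -/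
theorem sum_univ_boxVec {β : Type*} [AddCommMonoid β] (M : ℕ) (g : Site d → β) :
    ∑ r : Fin d → Fin M, g (boxVec M r) = ∑ v ∈ periodBox (d := d) M, g v := by
  rw [periodBox, Finset.sum_image fun r _ r' _ h => T4TermwiseTorus.boxVec_injective M h]

/-- **BLOCK-BY-BLOCK SUMMATION** for vector values (the tree's `sum_blocks_eq` is the real case):
`Σ_{y∈Y} Σ_{r} g(L•y + boxVec L r) = Σ_{x ∈ blockSites L Y} g x`. [folklore] -/
theorem sum_blocks_eq' {β : Type*} [AddCommMonoid β] (L : ℕ) (hL : 1 ≤ L) (Y : Finset (Site d)) (g : Site d → β) :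
    ∑ y ∈ Y, ∑ r : Fin d → Fin L, g ((L : ℤ) • y + boxVec L r) = ∑ x ∈ T4AveragingDeficitWall.blockSites L Y, g x := by
  rw [blockSites_eq_image, Finset.sum_image (fun a _ b _ h => blockMap_injective L hL h), Finset.sum_product]

/-- **THE BLOCKS OF `[0,L)^d` TILE `[0,ML)^d`**: `Σ_{y∈[0,L)^d} Σ_{v∈[0,M)^d} g(M•y + v) = Σ_{w∈[0,ML)^d} g w` (`M ≥ 1`). [folklore] -/
theorem sum_periodBox_blocks {β : Type*} [AddCommMonoid β] (M L : ℕ) (hM : 1 ≤ M) (g : Site d → β) :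
    ∑ y ∈ periodBox (d := d) L, ∑ v ∈ periodBox (d := d) M, g ((M : ℤ) • y + v) = ∑ w ∈ periodBox (d := d) (M * L), g w := by
  rw [← blockSites_periodBox M L hM, ← sum_blocks_eq' M hM]
  refine Finset.sum_congr rfl fun y _ => ?_
  rw [← sum_univ_boxVec]

/-! ## §2 The straight average written out; the tiling of its iterates -/

section Tiling

variable {𝔸 : Type*} [NormedRing 𝔸] [NormedAlgebra ℂ 𝔸]

/-- **ONE LEVEL WRITTEN OUT**: `Qcoarse L Y z κ = (L^d)⁻¹ • Σ_{v∈[0,L)^d} Σ_{i<L} Y(L•z + v + i•e_κ, κ)`. [cite: Balaban1985Averaging, (122) p.36] -/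
theorem Qcoarse_apply (L : ℕ) (Y : Site d → Fin d → 𝔸) (z : Site d) (κ : Fin d) :
    Qcoarse L Y z κ
      = (((L : ℝ) ^ d)⁻¹ : ℝ) • ∑ v ∈ periodBox (d := d) L, ∑ i ∈ range L, Y ((L : ℤ) • z + v + (i : ℤ) • e κ) κ := by
  unfold Qcoarse linQ
  rw [← Finset.smul_sum, ← sum_univ_boxVec]
  refine congrArg _ (Finset.sum_congr rfl fun r _ => ?_)
  rw [asum_seg_natCast]

/-- Rearranging the corner: `M•(L•z + v + i•e_κ) + w + t•e_κ = (M·L)•z + (M•v + w) + (M·i + t)•e_κ`. [folklore] -/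
theorem corner_rearrange (M L : ℕ) (z v w : Site d) (i t : ℕ) (κ : Fin d) :
    (M : ℤ) • ((L : ℤ) • z + v + (i : ℤ) • e κ) + w + (t : ℤ) • e κ
      = ((M * L : ℕ) : ℤ) • z + ((M : ℤ) • v + w) + (((M * i + t : ℕ) : ℤ)) • e κ := by
  push_cast
  simp only [smul_add, smul_smul, add_smul, mul_comm (M : ℤ) (L : ℤ)]
  abel

/-- **THE TILING — THE k-FOLD STRAIGHT AVERAGE IS THE BLOCK LINE MEAN**:
`(Qcoarse L)^[k] Y z κ = ((L^k)^d)⁻¹ • Σ_{v∈[0,L^k)^d} Σ_{i<L^k} Y(L^k•z + v + i•e_κ, κ)` (`L ≥ 1`).  Induction on `k`: the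
`L`-digits of the offset and of the position along the segment split off (`sum_periodBox_blocks`, `sum_range_mul`).
[cite: Balaban1984PropagatorsI, (1.20)–(1.21) p.20] -/
theorem iterate_Qcoarse_apply {L : ℕ} (hL : 1 ≤ L) :
    ∀ (k : ℕ) (Y : Site d → Fin d → 𝔸) (z : Site d) (κ : Fin d),
      (Qcoarse L)^[k] Y z κ
        = ((((L ^ k : ℕ) : ℝ) ^ d)⁻¹ : ℝ) •
            ∑ v ∈ periodBox (d := d) (L ^ k), ∑ i ∈ range (L ^ k), Y (((L ^ k : ℕ) : ℤ) • z + v + (i : ℤ) • e κ) κ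
  | 0, Y, z, κ => by
      -- `[0,1)^d = {0}`, one term
      have hbox : periodBox (d := d) 1 = {0} := by
        ext v
        rw [mem_periodBox, Finset.mem_singleton]
        constructor
        · intro h; funext κ'; have := h κ'; simp only [Nat.cast_one, Pi.zero_apply] at this ⊢; omega
        · rintro rfl κ'; simp
      simp [hbox]
  | k + 1, Y, z, κ => by
      have hM : 1 ≤ L ^ k := Nat.one_le_pow _ _ hL
      rw [Function.iterate_succ_apply', Qcoarse_apply]
      simp_rw [iterate_Qcoarse_apply hL k]
      -- collect the scalars
      rw [show (L ^ (k + 1) : ℕ) = L ^ k * L from pow_succ L k]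
      simp_rw [← Finset.smul_sum]
      rw [smul_smul]
      have hscal : (((L : ℝ) ^ d)⁻¹ : ℝ) * ((((L ^ k : ℕ) : ℝ) ^ d)⁻¹ : ℝ) = ((((L ^ k * L : ℕ) : ℝ) ^ d)⁻¹ : ℝ) := by
        push_cast
        rw [← mul_inv, ← mul_pow, mul_comm ((L : ℝ)) ((L : ℝ) ^ k)]
      rw [hscal]
      congr 1
      -- reindex: offsets by blocks, positions along the segment by digits
      rw [show range (L ^ k * L) = range (L * L ^ k) by rw [Nat.mul_comm]]
      simp_rw [sum_range_mul L (L ^ k)]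
      calc ∑ v ∈ periodBox (d := d) L, ∑ i ∈ range L, ∑ w ∈ periodBox (d := d) (L ^ k), ∑ t ∈ range (L ^ k),
              Y (((L ^ k : ℕ) : ℤ) • ((L : ℤ) • z + v + (i : ℤ) • e κ) + w + (t : ℤ) • e κ) κ
          = ∑ v ∈ periodBox (d := d) L, ∑ i ∈ range L, ∑ w ∈ periodBox (d := d) (L ^ k), ∑ t ∈ range (L ^ k),
              Y (((L ^ k * L : ℕ) : ℤ) • z + (((L ^ k : ℕ) : ℤ) • v + w) + (((L ^ k * i + t : ℕ) : ℤ)) • e κ) κ := by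
            refine Finset.sum_congr rfl fun v _ => Finset.sum_congr rfl fun i _ =>
              Finset.sum_congr rfl fun w _ => Finset.sum_congr rfl fun t _ => ?_
            rw [corner_rearrange]
        _ = ∑ v ∈ periodBox (d := d) L, ∑ w ∈ periodBox (d := d) (L ^ k), ∑ i ∈ range L, ∑ t ∈ range (L ^ k),
              Y (((L ^ k * L : ℕ) : ℤ) • z + (((L ^ k : ℕ) : ℤ) • v + w) + (((L ^ k * i + t : ℕ) : ℤ)) • e κ) κ :=
            Finset.sum_congr rfl fun v _ => Finset.sum_comm
        _ = ∑ u ∈ periodBox (d := d) (L ^ k * L), ∑ i ∈ range L, ∑ t ∈ range (L ^ k),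
              Y (((L ^ k * L : ℕ) : ℤ) • z + u + (((L ^ k * i + t : ℕ) : ℤ)) • e κ) κ :=
            sum_periodBox_blocks (L ^ k) L hM (fun u => ∑ i ∈ range L, ∑ t ∈ range (L ^ k),
              Y (((L ^ k * L : ℕ) : ℤ) • z + u + (((L ^ k * i + t : ℕ) : ℤ)) • e κ) κ)

end Tiling

/-! ## §3 The two estimates in the gradient currency (any norm) -/

section Estimates

variable {𝔸 : Type*} [NormedRing 𝔸] [NormedAlgebra ℂ 𝔸]

omit [NormedAlgebra ℂ 𝔸] in
/-- Telescoping along a segment: `Y(p + i•e_κ, κ) − Y(p, κ) = Σ_{j<i} (Y(p + (j+1)•e_κ, κ) − Y(p + j•e_κ, κ))`. [folklore] -/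
theorem sub_eq_sum_range_fd (Y : Site d → Fin d → 𝔸) (p : Site d) (κ : Fin d) (i : ℕ) :
    Y (p + (i : ℤ) • e κ) κ - Y p κ
      = ∑ j ∈ range i, (Y (p + ((j : ℤ) + 1) • e κ) κ - Y (p + (j : ℤ) • e κ) κ) := by
  have h := Finset.sum_range_sub (fun j : ℕ => Y (p + (j : ℤ) • e κ) κ) i
  simp only [Nat.cast_succ] at h
  rw [h]
  simp

omit [NormedAlgebra ℂ 𝔸] in
/-- Norm of a segment difference: `‖Y(p + i•e_κ) − Y(p)‖ ≤ Σ_{j<M} ‖∂_κY_κ(p + j•e_κ)‖` for `i ≤ M`. [folklore] -/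
theorem norm_sub_le_sum_fd (Y : Site d → Fin d → 𝔸) (p : Site d) (κ : Fin d) {i M : ℕ} (hi : i ≤ M) :
    ‖Y (p + (i : ℤ) • e κ) κ - Y p κ‖
      ≤ ∑ j ∈ range M, ‖Y (p + ((j : ℤ) + 1) • e κ) κ - Y (p + (j : ℤ) • e κ) κ‖ := by
  rw [sub_eq_sum_range_fd]
  refine (norm_sum_le _ _).trans ?_
  exact Finset.sum_le_sum_of_subset_of_nonneg (Finset.range_mono hi) fun _ _ _ => norm_nonneg _

/-- **THE LINE MEAN MINUS THE BLOCK MEAN, IN THE GRADIENT CURRENCY**: for every finite offset set `B`,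
`‖Σ_{v∈B} Σ_{i<M} Y(q+v+i•e_κ,κ) − M•Σ_{v∈B} Y(q+v,κ)‖ ≤ M·Σ_{v∈B} Σ_{j<M} ‖Y(q+v+(j+1)•e_κ,κ) − Y(q+v+j•e_κ,κ)‖`. [folklore] -/
theorem norm_lineMean_sub_blockMean_le (Y : Site d → Fin d → 𝔸) (q : Site d) (κ : Fin d) (B : Finset (Site d)) (M : ℕ) :
    ‖∑ v ∈ B, ∑ i ∈ range M, Y (q + v + (i : ℤ) • e κ) κ - (M : ℝ) • ∑ v ∈ B, Y (q + v) κ‖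
      ≤ M * ∑ v ∈ B, ∑ j ∈ range M, ‖Y (q + v + ((j : ℤ) + 1) • e κ) κ - Y (q + v + (j : ℤ) • e κ) κ‖ := by
  have hre : ∑ v ∈ B, ∑ i ∈ range M, Y (q + v + (i : ℤ) • e κ) κ - (M : ℝ) • ∑ v ∈ B, Y (q + v) κ
      = ∑ v ∈ B, ∑ i ∈ range M, (Y (q + v + (i : ℤ) • e κ) κ - Y (q + v) κ) := by
    rw [Finset.smul_sum, ← Finset.sum_sub_distrib]
    refine Finset.sum_congr rfl fun v _ => ?_
    rw [Finset.sum_sub_distrib, Finset.sum_const, card_range, ← Nat.cast_smul_eq_nsmul ℝ]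
  rw [hre]
  refine (norm_sum_le _ _).trans ?_
  rw [Finset.mul_sum]
  refine Finset.sum_le_sum fun v _ => ?_
  refine (norm_sum_le _ _).trans ?_
  calc ∑ i ∈ range M, ‖Y (q + v + (i : ℤ) • e κ) κ - Y (q + v) κ‖
      ≤ ∑ _i ∈ range M, ∑ j ∈ range M, ‖Y (q + v + ((j : ℤ) + 1) • e κ) κ - Y (q + v + (j : ℤ) • e κ) κ‖ :=
        Finset.sum_le_sum fun i hi => norm_sub_le_sum_fd Y (q + v) κ (Finset.mem_range.mp hi).le
    _ = M * ∑ j ∈ range M, ‖Y (q + v + ((j : ℤ) + 1) • e κ) κ - Y (q + v + (j : ℤ) • e κ) κ‖ := by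
        rw [Finset.sum_const, card_range, nsmul_eq_mul]

/-- … squared (Cauchy–Schwarz over the `#B·M` terms):
`‖…‖² ≤ M²·(#B·M)·Σ_{v∈B} Σ_{j<M} ‖∂_κY_κ(q+v+j•e_κ)‖²`. [folklore] -/
theorem norm_lineMean_sub_blockMean_sq_le (Y : Site d → Fin d → 𝔸) (q : Site d) (κ : Fin d) (B : Finset (Site d))
    (M : ℕ) :
    ‖∑ v ∈ B, ∑ i ∈ range M, Y (q + v + (i : ℤ) • e κ) κ - (M : ℝ) • ∑ v ∈ B, Y (q + v) κ‖ ^ 2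
      ≤ (M : ℝ) ^ 2 * (B.card * M)
          * ∑ v ∈ B, ∑ j ∈ range M, ‖Y (q + v + ((j : ℤ) + 1) • e κ) κ - Y (q + v + (j : ℤ) • e κ) κ‖ ^ 2 := by
  have h := norm_lineMean_sub_blockMean_le Y q κ B M
  have h0 : 0 ≤ ‖∑ v ∈ B, ∑ i ∈ range M, Y (q + v + (i : ℤ) • e κ) κ - (M : ℝ) • ∑ v ∈ B, Y (q + v) κ‖ :=
    norm_nonneg _
  have hcs := sq_sum_le_card_mul_sum_sq (s := B ×ˢ range M)
    (f := fun p : Site d × ℕ => ‖Y (q + p.1 + ((p.2 : ℤ) + 1) • e κ) κ - Y (q + p.1 + (p.2 : ℤ) • e κ) κ‖)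
  rw [Finset.sum_product, Finset.sum_product, Finset.card_product, card_range] at hcs
  push_cast at hcs
  calc ‖∑ v ∈ B, ∑ i ∈ range M, Y (q + v + (i : ℤ) • e κ) κ - (M : ℝ) • ∑ v ∈ B, Y (q + v) κ‖ ^ 2
      ≤ ((M : ℝ) * ∑ v ∈ B, ∑ j ∈ range M, ‖Y (q + v + ((j : ℤ) + 1) • e κ) κ - Y (q + v + (j : ℤ) • e κ) κ‖) ^ 2 :=
        pow_le_pow_left₀ h0 h 2
    _ = (M : ℝ) ^ 2 * (∑ v ∈ B, ∑ j ∈ range M, ‖Y (q + v + ((j : ℤ) + 1) • e κ) κ - Y (q + v + (j : ℤ) • e κ) κ‖) ^ 2 := by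
        ring
    _ ≤ (M : ℝ) ^ 2 * ((B.card * M)
          * ∑ v ∈ B, ∑ j ∈ range M, ‖Y (q + v + ((j : ℤ) + 1) • e κ) κ - Y (q + v + (j : ℤ) • e κ) κ‖ ^ 2) :=
        mul_le_mul_of_nonneg_left hcs (sq_nonneg _)
    _ = _ := by ring

omit [NormedAlgebra ℂ 𝔸] in
/-- Telescoping across a whole block: `Y(p, κ) − Y(p − M•e_κ, κ) = Σ_{j<M} ∂_κY_κ(p − M•e_κ + j•e_κ)`. [folklore] -/
theorem sub_shift_eq_sum_range_fd (Y : Site d → Fin d → 𝔸) (p : Site d) (κ : Fin d) (M : ℕ) :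
    Y p κ - Y (p - (M : ℤ) • e κ) κ
      = ∑ j ∈ range M, (Y (p - (M : ℤ) • e κ + ((j : ℤ) + 1) • e κ) κ - Y (p - (M : ℤ) • e κ + (j : ℤ) • e κ) κ) := by
  have h := sub_eq_sum_range_fd Y (p - (M : ℤ) • e κ) κ M
  rw [sub_add_cancel] at h
  exact h

omit [NormedAlgebra ℂ 𝔸] in
/-- **THE COARSE BACKWARD DIFFERENCE OF THE LINE MEAN, IN THE GRADIENT CURRENCY**:
`‖Σ_{v∈B}Σ_{i<M} Y(q+v+i•e_κ,κ) − Σ_{v∈B}Σ_{i<M} Y(q−M•e_κ+v+i•e_κ,κ)‖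
≤ Σ_{v∈B} Σ_{i<M} Σ_{j<M} ‖∂_κY_κ(q + v + i•e_κ − M•e_κ + j•e_κ)‖`. [folklore] -/
theorem norm_lineMean_sub_shift_le (Y : Site d → Fin d → 𝔸) (q : Site d) (κ : Fin d) (B : Finset (Site d)) (M : ℕ) :
    ‖∑ v ∈ B, ∑ i ∈ range M, Y (q + v + (i : ℤ) • e κ) κ
        - ∑ v ∈ B, ∑ i ∈ range M, Y (q - (M : ℤ) • e κ + v + (i : ℤ) • e κ) κ‖
      ≤ ∑ v ∈ B, ∑ i ∈ range M, ∑ j ∈ range M,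
          ‖Y (q + v + (i : ℤ) • e κ - (M : ℤ) • e κ + ((j : ℤ) + 1) • e κ) κ
            - Y (q + v + (i : ℤ) • e κ - (M : ℤ) • e κ + (j : ℤ) • e κ) κ‖ := by
  rw [← Finset.sum_sub_distrib]
  refine (norm_sum_le _ _).trans (Finset.sum_le_sum fun v _ => ?_)
  rw [← Finset.sum_sub_distrib]
  refine (norm_sum_le _ _).trans (Finset.sum_le_sum fun i _ => ?_)
  have hq : q - (M : ℤ) • e κ + v + (i : ℤ) • e κ = q + v + (i : ℤ) • e κ - (M : ℤ) • e κ := by abel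
  rw [hq, sub_shift_eq_sum_range_fd Y (q + v + (i : ℤ) • e κ) κ M]
  exact norm_sum_le _ _

omit [NormedAlgebra ℂ 𝔸] in
/-- … squared (Cauchy–Schwarz over the `#B·M·M` terms). [folklore] -/
theorem norm_lineMean_sub_shift_sq_le (Y : Site d → Fin d → 𝔸) (q : Site d) (κ : Fin d) (B : Finset (Site d)) (M : ℕ) :
    ‖∑ v ∈ B, ∑ i ∈ range M, Y (q + v + (i : ℤ) • e κ) κ
        - ∑ v ∈ B, ∑ i ∈ range M, Y (q - (M : ℤ) • e κ + v + (i : ℤ) • e κ) κ‖ ^ 2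
      ≤ (B.card * M * M : ℝ) * ∑ v ∈ B, ∑ i ∈ range M, ∑ j ∈ range M,
          ‖Y (q + v + (i : ℤ) • e κ - (M : ℤ) • e κ + ((j : ℤ) + 1) • e κ) κ
            - Y (q + v + (i : ℤ) • e κ - (M : ℤ) • e κ + (j : ℤ) • e κ) κ‖ ^ 2 := by
  have h := norm_lineMean_sub_shift_le Y q κ B M
  have hcs := sq_sum_le_card_mul_sum_sq (s := B ×ˢ (range M ×ˢ range M))
    (f := fun p : Site d × (ℕ × ℕ) => ‖Y (q + p.1 + (p.2.1 : ℤ) • e κ - (M : ℤ) • e κ + ((p.2.2 : ℤ) + 1) • e κ) κ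
        - Y (q + p.1 + (p.2.1 : ℤ) • e κ - (M : ℤ) • e κ + (p.2.2 : ℤ) • e κ) κ‖)
  rw [Finset.sum_product, Finset.card_product, Finset.card_product, card_range] at hcs
  simp_rw [Finset.sum_product] at hcs
  push_cast at hcs
  refine (pow_le_pow_left₀ (norm_nonneg _) h 2).trans ?_
  rw [← mul_assoc] at hcs
  exact hcs

end Estimates

end

end Summit.QuantumFields.BalabanUV.T4Continuum.NE3BlockLineAverage
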